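import Summits.CriticalPhenomena.PercolationContinuityZ3.Theses.PercNearOneGluing
import Literature.Probability.Percolation.PercolationProofs
import Literature.Probability.Percolation.ConditionalPositiveAssociationProofs
import Literature.Probability.Percolation.TwoClusterConditionalAssociationProofs

/-! TTRL-lite variant V131 of stmt-CriticalPhenomena-4576

(`stub_goodStep`, move `specialise+small_case`: `n := 2`, `A.card ≤ 1`).  No new definitions,
no named facts. -/

namespace Summit.CriticalPhenomena.PercolationContinuityZ3.Theorems

open MeasureTheory Literature.Probability.LatticeModels Literature.Probability.Percolation
open scoped Classical BigOperators

/-- TTRL-lite variant V131 of `stub_goodStep` (stmt-CriticalPhenomena-4576): the inductive step of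
the good-quadruple inequality on two vertices with `A.card ≤ 1`.  The hypotheses are contradictory:
`b ∈ A` and `o ∉ A` give `o ≠ b`, and the low neighbour `y ∉ A`, `y ≠ o` would be a third element
of `Fin 2`.  Hence the statement holds vacuously. -/
theorem stub_goodStep_var131 : ∀ (w : Sym2 (Fin 2) → unitInterval) (A : Finset (Fin 2)) (o b : Fin 2), A.card ≤ 1 → b ∈ A → o ∉ A → (∃ y : Fin 2, y ∉ A ∧ y ≠ o ∧ (w s(o, y) : ℝ) ≠ 0) → (∀ w' : Sym2 (Fin 2) → unitInterval, (Finset.univ.filter (fun v : Fin 2 => ∃ u : Fin 2, 0 < (w' s(u, v) : ℝ))).card < (Finset.univ.filter (fun v : Fin 2 => ∃ u : Fin 2, 0 < (w s(u, v) : ℝ))).card → ∀ (A' : Finset (Fin 2)) (o' b' : Fin 2), b' ∈ A' → o' ∉ A' → ∀ (t : ℝ) (sel : Finset (Fin 2) → Fin 2), (∀ W, sel W ∈ A') → (∀ a ∈ A', 1 - t ≤ (prodBernoulli w').real (openConn a b')) → (prodBernoulli w').real ((⋃ a ∈ A', openConn o' a) ∩ (openConn o' b')ᶜ) + ∑ W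 ∈ (Finset.univ : Finset (Finset (Fin 2))).filter (fun W => o' ∈ W ∧ Disjoint W A'), (prodBernoulli w').real {ω : BondConfig (Fin 2) | openCluster ω o' = (W : Set (Fin 2))} * (prodBernoulli w').real (openConnIn ((W : Set (Fin 2))ᶜ) (sel W) b')ᶜ ≤ t) → ∀ (t : ℝ) (sel : Finset (Fin 2) → Fin 2), (∀ W, sel W ∈ A) → (∀ a ∈ A, 1 - t ≤ (prodBernoulli w).real (openConn a b)) → (prodBernoulli w).real ((⋃ a ∈ A, openConn o a) ∩ (openConn o b)ᶜ) + ∑ W ∈ (Finset.univ : Finset (Finset (Fin 2))).filter (fun W => o ∈ W ∧ Disjoint W A), (prodBernoulli w).real {ω : BondConfig (Fin 2) | openCluster ω o = (W : Set (Fin 2))} * (prodBernoulli w).real (openConnIn ((W : Set (Fin 2))ᶜ) (sel W) b)ᶜ ≤ t := by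
  intro w A o b _hcard hbA hoA hy _hIH t sel _hsel _hlev
  exfalso
  obtain ⟨y, hyA, hyo, _⟩ := hy
  have hob : o.val ≠ b.val := fun h => hoA (Fin.ext h ▸ hbA)
  have hyb : y.val ≠ b.val := fun h => hyA (Fin.ext h ▸ hbA)
  have hyo' : y.val ≠ o.val := fun h => hyo (Fin.ext h)
  have h1 := o.isLt
  have h2 := b.isLt
  have h3 := y.isLt
  omega

end Summit.CriticalPhenomena.PercolationContinuityZ3.Theorems
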